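import Literature.Analysis.FluidPDE.RieszPressureModConst
import HarnessLib

/-!
# The Riesz pressure of a bounded field, modulo constants: the weak Poisson equation

Analysis/FluidPDE support file (all results proved; no definitions, no named facts), companion of
`RieszPressureModConst.lean`. For `v ∈ C⁴` bounded and every test function `φ ∈ C^∞_c(ℝ³)` the
Riesz pressure modulo constants `Q̃ = pressurePotentialMod x₀ v` satisfies

  `∫ Q̃ Δφ = −∫ D²φ(v, v)`,

i.e. `ΔQ̃ = −∂ᵢ∂ⱼ(vᵢvⱼ)` in the sense of distributions (Seregin 2014, Lemma 6.5: the `BMO`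
pressure `q_F` of a bounded tensor `F` solves `Δq_F = −div div F` in `𝒟'`; here `F = v ⊗ v`).
The near part is the tree's classical `ΔQ₁ = G − λ * G` (`laplacian_nearPotential`,
Gilbarg–Trudinger (2.17)) and Green's identity; the far part is done WITHOUT differentiating the
renormalised far potential: Fubini (the kernel difference `D²Γ∞(x−y) − D²Γ∞(x₀−y)` is
`O((1+|y|)⁻⁴)` uniformly for `x` in the support of `φ`), Green's identity against the smooth kernel
`x ↦ D²Γ∞(x−y)(a,a)` whose Laplacian is `D²λ(x−y)(a,a)` (`λ = ΔΓ∞`, the trace identity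
`sum_fderiv4_newtonFar_apply`), `∫ Δφ = 0` for the renormalising constant, and the double
integration by parts `∫ D²λ(x−y)(v y, v y) dy = ∫ λ(z) G[v](x−z) dz`
(`integral_comp_sub_mul_pressureSource`). The `λ * G` terms cancel.

## References

* G. Seregin, *Lecture Notes on Regularity Theory for the Navier–Stokes Equations* (2014),
  §6.2 Lemma 6.5. [Seregin2014]
* D. Gilbarg, N. S. Trudinger, *Elliptic PDE of Second Order* (2001), Lemma 4.2, (2.17).
  [GilbargTrudinger2001]

## Mathlib / tree search

Tree: `laplacian_nearPotential`, `contDiff_nearPotential`, `integral_mul_pressureSource`,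
`integral_comp_sub_mul_pressureSource`, `sum_fderiv4_newtonFar_apply`, `integral_mul_laplacian_comm`,
`continuous_integral_smul_comp_sub`, `tsupport_newtonFarLaplacian_subset`. Mathlib:
`integral_integral_swap`, `Integrable.mul_prod`, `iteratedFDeriv_comp_add_right`,
`InnerProductSpace.laplacian_const`.
-/

noncomputable section

open MeasureTheory Set Filter Metric Topology InnerProductSpace Function
open scoped RealInnerProductSpace ContDiff ENNReal Laplacian

namespace Literature.Analysis.FluidPDE

open Literature.Analysis.FluidPDE.FourierNS (HasDecay)
open Literature.Analysis.FluidPDE.PineauVicol2026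
open RieszPressureModConst

-- nested operator types `ℝ³ →L[ℝ] ℝ³ →L[ℝ] ℝ³ →L[ℝ] ℝ`
set_option maxSynthPendingDepth 3

/-- `(1 + |y|)⁻⁴` is integrable on `ℝ³` (private helper). [folklore] -/
private theorem integrable_inv_one_add_norm_pow_four' :
    Integrable fun y : EuclideanSpace ℝ (Fin 3) => ((1 + ‖y‖) ^ 4)⁻¹ := by
  have h := integrable_one_add_norm (E := EuclideanSpace ℝ (Fin 3)) (μ := volume) (r := 4)
    (by simp; norm_num)
  refine h.congr (Eventually.of_forall fun y => ?_)
  have h0 : 0 < 1 + ‖y‖ := by positivity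
  show (1 + ‖y‖) ^ (-(4 : ℝ)) = ((1 + ‖y‖) ^ 4)⁻¹
  rw [Real.rpow_neg h0.le, show (4 : ℝ) = ((4 : ℕ) : ℝ) by norm_num, Real.rpow_natCast]

/-! ### The weak pressure Poisson equation `∫ Q̃ Δφ = −∫ D²φ(v, v)` -/

section Poisson

variable {r₀ r₁ : ℝ}

/-- `Δ_w (D²Γ∞(w)(a,a)) = D²λ(w)(a,a)`, `λ = ΔΓ∞` (Schwarz; the trace identity
`sum_fderiv4_newtonFar_apply` of the tree). [cite: GilbargTrudinger2001, Lemma 4.2] -/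
theorem laplacian_fderiv2_newtonFar_apply (h₀ : 0 < r₀) (h₁ : r₀ < r₁)
    (a z : EuclideanSpace ℝ (Fin 3)) :
    (Δ (fun w => fderiv ℝ (fderiv ℝ (newtonFar r₀ r₁)) w a a)) z =
      fderiv ℝ (fderiv ℝ (newtonFarLaplacian r₀ r₁)) z a a := by
  set Φ := fderiv ℝ (fderiv ℝ (newtonFar r₀ r₁)) with hΦ
  have hΦs : ContDiff ℝ 2 Φ := contDiff_fderiv2_newtonFar h₀ h₁
  have hΦd : Differentiable ℝ Φ := hΦs.differentiable two_ne_zero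
  have hDΦd : Differentiable ℝ (fderiv ℝ Φ) :=
    (hΦs.fderiv_right (m := 1) le_rfl).differentiable one_ne_zero
  have hfa : ContDiff ℝ 2 (fun w => Φ w a a) := (hΦs.clm_apply contDiff_const).clm_apply contDiff_const
  set b := stdOrthonormalBasis ℝ (EuclideanSpace ℝ (Fin 3)) with hb
  rw [FluidPDE.laplacian_eq_sum_fderiv_fderiv b hfa z, ← sum_fderiv4_newtonFar_apply h₀ h₁ b z a]
  refine Finset.sum_congr rfl fun i _ => ?_
  -- evaluation at `(a, a)` commutes with the two outer derivatives
  have e1 : (fun w => fderiv ℝ (fun w => Φ w a a) w (b i)) =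
      fun w => evalDiag a (fderiv ℝ Φ w (b i)) := by
    funext w
    have : (fun w => Φ w a a) = fun w => evalDiag a (Φ w) := rfl
    rw [this, fderiv_clm_apply (differentiableAt_const _) (hΦd w)]
    simp
  rw [e1, fderiv_clm_apply (differentiableAt_const _) ((hDΦd z).clm_apply
    (differentiableAt_const _))]
  simp only [fderiv_fun_const, Pi.zero_apply, ContinuousLinearMap.flip_zero,
    _root_.zero_apply, add_zero, ContinuousLinearMap.coe_comp, comp_apply, evalDiag_apply]
  rw [FluidPDE.fderiv_apply_const_apply (hDΦd z)]

/-- Translation: `Δ(g(· − y))(x) = (Δg)(x − y)`. [folklore] -/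
private theorem laplacian_comp_sub_const_aux {F : Type*} [NormedAddCommGroup F] [NormedSpace ℝ F]
    (g : EuclideanSpace ℝ (Fin 3) → F) (y x : EuclideanSpace ℝ (Fin 3)) :
    (Δ (fun w => g (w - y))) x = (Δ g) (x - y) := by
  rw [laplacian_eq_iteratedFDeriv_stdOrthonormalBasis, laplacian_eq_iteratedFDeriv_stdOrthonormalBasis]
  simp only [sub_eq_add_neg, iteratedFDeriv_comp_add_right]

/-- `∫ Δφ = 0` for `φ ∈ C²_c`. [folklore] -/
private theorem integral_laplacian_eq_zero_aux {φ : EuclideanSpace ℝ (Fin 3) → ℝ} (hφ : ContDiff ℝ 2 φ)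
    (hφc : HasCompactSupport φ) : ∫ x, (Δ φ) x = 0 := by
  have h := integral_mul_laplacian_comm (f := fun _ : EuclideanSpace ℝ (Fin 3) => (1 : ℝ))
    contDiff_const hφ hφc
  simp only [InnerProductSpace.laplacian_const, Pi.zero_apply, mul_zero, integral_zero, mul_one] at h
  exact h.symm

/-- **Green's identity against the far kernel**: for `φ ∈ C²_c` and fixed `y, a`,
`∫ D²Γ∞(x−y)(a,a) Δφ(x) dx = ∫ D²λ(x−y)(a,a) φ(x) dx`. [cite: GilbargTrudinger2001, Lemma 4.2] -/
theorem integral_fderiv2_newtonFar_apply_mul_laplacian (h₀ : 0 < r₀) (h₁ : r₀ < r₁)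
    {φ : EuclideanSpace ℝ (Fin 3) → ℝ} (hφ : ContDiff ℝ 2 φ) (hφc : HasCompactSupport φ)
    (y a : EuclideanSpace ℝ (Fin 3)) :
    ∫ x, fderiv ℝ (fderiv ℝ (newtonFar r₀ r₁)) (x - y) a a * (Δ φ) x =
      ∫ x, fderiv ℝ (fderiv ℝ (newtonFarLaplacian r₀ r₁)) (x - y) a a * φ x := by
  set Φ := fderiv ℝ (fderiv ℝ (newtonFar r₀ r₁)) with hΦ
  have hΦs : ContDiff ℝ 2 Φ := contDiff_fderiv2_newtonFar h₀ h₁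
  have hfa : ContDiff ℝ 2 (fun w => Φ w a a) := (hΦs.clm_apply contDiff_const).clm_apply contDiff_const
  have hf : ContDiff ℝ 2 (fun x => Φ (x - y) a a) := hfa.comp (contDiff_id.sub contDiff_const)
  have h := integral_mul_laplacian_comm hf hφ hφc
  calc ∫ x, Φ (x - y) a a * (Δ φ) x = ∫ x, φ x * (Δ (fun x => Φ (x - y) a a)) x := by
        rw [h]; exact integral_congr_ae (Eventually.of_forall fun x => mul_comm _ _)
    _ = ∫ x, fderiv ℝ (fderiv ℝ (newtonFarLaplacian r₀ r₁)) (x - y) a a * φ x := by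
        refine integral_congr_ae (Eventually.of_forall fun x => ?_)
        have e : (Δ (fun x => Φ (x - y) a a)) x = fderiv ℝ (fderiv ℝ (newtonFarLaplacian r₀ r₁)) (x - y) a a := by
          rw [laplacian_comp_sub_const_aux (fun w => Φ w a a) y x, laplacian_fderiv2_newtonFar_apply h₀ h₁]
        dsimp only
        rw [e, mul_comm]

/-- `D²λ` vanishes off the closed ball of radius `r₁` (so does `λ`). [folklore] -/
private theorem fderiv2_newtonFarLaplacian_eq_zero (h₀ : 0 ≤ r₀) (h₁ : r₀ < r₁)
    {z : EuclideanSpace ℝ (Fin 3)} (hz : r₁ < ‖z‖) :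
    fderiv ℝ (fderiv ℝ (newtonFarLaplacian r₀ r₁)) z = 0 := by
  have h1 : z ∉ tsupport (newtonFarLaplacian r₀ r₁) := fun h => by
    have := tsupport_newtonFarLaplacian_subset h₀ h₁ h
    rw [mem_closedBall_zero_iff] at this
    linarith
  exact fderiv_of_notMem_tsupport ℝ fun h => h1 (tsupport_fderiv_subset ℝ h)

/-- **The weak Laplacian of the renormalised far potential**: for `v ∈ C²` bounded and
`φ ∈ C^∞_c`, `∫ farPotentialMod r₀ r₁ x₀ v · Δφ = ∫ φ (λ * G[v])` with
`(λ * G)(x) = ∫ λ(z) G[v](x − z) dz` (Fubini, Green against the kernel, `∫Δφ = 0` for the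
renormalising constant, and the double integration by parts `∫ D²λ(x−y)(v y,v y) dy = (λ*G)(x)`).
[cite: GilbargTrudinger2001, Lemma 4.2] -/
theorem integral_farPotentialMod_mul_laplacian (h₀ : 0 < r₀) (h₁ : r₀ < r₁)
    {v : EuclideanSpace ℝ (Fin 3) → EuclideanSpace ℝ (Fin 3)} (hv : ContDiff ℝ 2 v) {N : ℝ}
    (hN : ∀ y, ‖v y‖ ≤ N) (x₀ : EuclideanSpace ℝ (Fin 3))
    {φ : EuclideanSpace ℝ (Fin 3) → ℝ} (hφ : ContDiff ℝ 2 φ) (hφc : HasCompactSupport φ) :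
    ∫ x, farPotentialMod r₀ r₁ x₀ v x * (Δ φ) x =
      ∫ x, φ x * ∫ z, newtonFarLaplacian r₀ r₁ z * pressureSource v (x - z) := by
  set K := fderiv ℝ (fderiv ℝ (newtonFar r₀ r₁)) with hK
  set L := fderiv ℝ (fderiv ℝ (newtonFarLaplacian r₀ r₁)) with hL
  have hvc : Continuous v := hv.continuous
  have hKc : Continuous K := (contDiff_fderiv2_newtonFar h₀ h₁).continuous
  have hlam : ContDiff ℝ 2 (newtonFarLaplacian r₀ r₁) := contDiff_newtonFarLaplacian h₀ h₁
  have hLc : Continuous L := (hlam.fderiv_right (m := 1) le_rfl).continuous_fderiv one_ne_zero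
  have hΔφc : Continuous (Δ φ) := FluidPDE.continuous_laplacian hφ
  have hΔφs : HasCompactSupport (Δ φ) := hφc.mono' fun x hx => by
    contrapose! hx
    simp [FluidPDE.laplacian_eq_zero_of_notMem_tsupport hx]
  -- a ball containing the supports
  obtain ⟨R, hR⟩ := (hφc.isCompact.isBounded).subset_closedBall (0 : EuclideanSpace ℝ (Fin 3))
  have hsuppφ : ∀ x, φ x ≠ 0 → ‖x‖ ≤ R := fun x hx =>
    mem_closedBall_zero_iff.1 (hR (subset_tsupport _ hx))
  have hsuppΔ : ∀ x, (Δ φ) x ≠ 0 → ‖x‖ ≤ R := fun x hx => by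
    by_contra h
    exact hx (FluidPDE.laplacian_eq_zero_of_notMem_tsupport fun h' =>
      h (mem_closedBall_zero_iff.1 (hR h')))
  set ρ := max (max R ‖x₀‖) 0 with hρ
  have hρ0 : 0 ≤ ρ := le_max_right _ _
  have hRρ : R ≤ ρ := (le_max_left _ _).trans (le_max_left _ _)
  have hx₀ρ : ‖x₀‖ ≤ ρ := (le_max_right _ _).trans (le_max_left _ _)
  obtain ⟨M, hM0, hM⟩ := exists_norm_farPotentialMod_integrand_le h₀ h₁
  -- Step 1: Fubini for `(x, y) ↦ (K(x−y) − K(x₀−y))(v y, v y) Δφ(x)`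
  set C : ℝ := M * (1 + ρ) ^ 4 * (2 * ρ) * N ^ 2 with hC
  have hprod : Integrable (fun p : EuclideanSpace ℝ (Fin 3) × EuclideanSpace ℝ (Fin 3) =>
      (K (p.1 - p.2) - K (x₀ - p.2)) (v p.2) (v p.2) * (Δ φ) p.1) (volume.prod volume) := by
    have hcont : Continuous fun p : EuclideanSpace ℝ (Fin 3) × EuclideanSpace ℝ (Fin 3) =>
        (K (p.1 - p.2) - K (x₀ - p.2)) (v p.2) (v p.2) * (Δ φ) p.1 :=
      ((((hKc.comp (continuous_fst.sub continuous_snd)).sub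
        (hKc.comp (continuous_const.sub continuous_snd))).clm_apply (hvc.comp continuous_snd)).clm_apply
        (hvc.comp continuous_snd)).mul (hΔφc.comp continuous_fst)
    have hdom : Integrable (fun p : EuclideanSpace ℝ (Fin 3) × EuclideanSpace ℝ (Fin 3) =>
        ‖(Δ φ) p.1‖ * (C * ((1 + ‖p.2‖) ^ 4)⁻¹)) (volume.prod volume) :=
      (hΔφc.integrable_of_hasCompactSupport hΔφs).norm.mul_prod
        (integrable_inv_one_add_norm_pow_four'.const_mul C)
    refine hdom.mono' hcont.aestronglyMeasurable (Eventually.of_forall fun p => ?_)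
    rw [norm_mul]
    by_cases hp : (Δ φ) p.1 = 0
    · simp [hp]
    · have hp1 : ‖p.1‖ ≤ ρ := (hsuppΔ p.1 hp).trans hRρ
      have hb := hM v N hN ρ p.1 x₀ p.2 hp1 hx₀ρ
      have hxx : ‖p.1 - x₀‖ ≤ 2 * ρ := (norm_sub_le _ _).trans (by linarith)
      have hN2 : 0 ≤ N ^ 2 := sq_nonneg N
      have h4 : 0 ≤ ((1 + ‖p.2‖) ^ 4)⁻¹ := by positivity
      have hb' : ‖(K (p.1 - p.2) - K (x₀ - p.2)) (v p.2) (v p.2)‖ ≤ C * ((1 + ‖p.2‖) ^ 4)⁻¹ := by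
        refine hb.trans ?_
        rw [hC]
        have : M * (1 + ρ) ^ 4 * ‖p.1 - x₀‖ ≤ M * (1 + ρ) ^ 4 * (2 * ρ) :=
          mul_le_mul_of_nonneg_left hxx (by positivity)
        exact mul_le_mul_of_nonneg_right (mul_le_mul_of_nonneg_right this hN2) h4
      rw [mul_comm]
      exact mul_le_mul_of_nonneg_left hb' (norm_nonneg _)
  have step1 : ∫ x, farPotentialMod r₀ r₁ x₀ v x * (Δ φ) x =
      ∫ y, ∫ x, (K (x - y) - K (x₀ - y)) (v y) (v y) * (Δ φ) x := by
    unfold farPotentialMod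
    simp_rw [← integral_mul_const]
    exact integral_integral_swap hprod
  -- Step 2: the inner `x`-integral, for fixed `y`
  have step2 : ∀ y, ∫ x, (K (x - y) - K (x₀ - y)) (v y) (v y) * (Δ φ) x =
      ∫ x, L (x - y) (v y) (v y) * φ x := by
    intro y
    have i1 : Integrable fun x => K (x - y) (v y) (v y) * (Δ φ) x :=
      ((((hKc.comp (continuous_id.sub continuous_const)).clm_apply continuous_const).clm_apply
        continuous_const).mul hΔφc).integrable_of_hasCompactSupport hΔφs.mul_left
    have i2 : Integrable fun x => K (x₀ - y) (v y) (v y) * (Δ φ) x :=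
      (continuous_const.mul hΔφc).integrable_of_hasCompactSupport hΔφs.mul_left
    have e : ∀ x, (K (x - y) - K (x₀ - y)) (v y) (v y) * (Δ φ) x =
        K (x - y) (v y) (v y) * (Δ φ) x - K (x₀ - y) (v y) (v y) * (Δ φ) x := fun x => by
      simp only [sub_apply]; ring
    simp_rw [e]
    rw [integral_sub i1 i2, integral_const_mul, integral_laplacian_eq_zero_aux hφ hφc, mul_zero, sub_zero]
    exact integral_fderiv2_newtonFar_apply_mul_laplacian h₀ h₁ hφ hφc y (v y)
  simp_rw [step1, step2]
  -- Step 3: Fubini back; the integrand `L(x−y)(v y,v y) φ x` has compact support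
  have hcs : HasCompactSupport fun p : EuclideanSpace ℝ (Fin 3) × EuclideanSpace ℝ (Fin 3) =>
      L (p.1 - p.2) (v p.2) (v p.2) * φ p.1 := by
    refine HasCompactSupport.intro ((isCompact_closedBall (0 : EuclideanSpace ℝ (Fin 3)) ρ).prod
      (isCompact_closedBall (0 : EuclideanSpace ℝ (Fin 3)) (ρ + r₁))) fun p hp => ?_
    rw [Set.mem_prod, mem_closedBall_zero_iff, mem_closedBall_zero_iff, not_and_or, not_le, not_le] at hp
    rcases hp with hp | hp
    · have : φ p.1 = 0 := by
        by_contra h; exact absurd ((hsuppφ p.1 h).trans hRρ) (not_le.2 hp)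
      simp [this]
    · by_cases hφ0 : φ p.1 = 0
      · simp [hφ0]
      · have hp1 : ‖p.1‖ ≤ ρ := (hsuppφ p.1 hφ0).trans hRρ
        have hz : r₁ < ‖p.1 - p.2‖ := by
          have := norm_sub_norm_le p.2 p.1
          rw [norm_sub_rev] at this
          linarith
        simp [hL, fderiv2_newtonFarLaplacian_eq_zero h₀.le h₁ hz]
  have hprod2 : Integrable (fun p : EuclideanSpace ℝ (Fin 3) × EuclideanSpace ℝ (Fin 3) =>
      L (p.1 - p.2) (v p.2) (v p.2) * φ p.1) (volume.prod volume) :=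
    ((((hLc.comp (continuous_fst.sub continuous_snd)).clm_apply (hvc.comp continuous_snd)).clm_apply
      (hvc.comp continuous_snd)).mul (hφ.continuous.comp continuous_fst)).integrable_of_hasCompactSupport hcs
  have step3 : ∫ y, ∫ x, L (x - y) (v y) (v y) * φ x = ∫ x, ∫ y, L (x - y) (v y) (v y) * φ x :=
    (integral_integral_swap hprod2).symm
  rw [step3]
  refine integral_congr_ae (Eventually.of_forall fun x => ?_)
  -- Step 4: `∫ D²λ(x−y)(v y,v y) dy = ∫ λ(z) G(x−z) dz`
  have e4 : ∫ y, L (x - y) (v y) (v y) * φ x = φ x * ∫ y, L (x - y) (v y) (v y) :=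
    (integral_mul_const (φ x) _).trans (mul_comm _ _)
  dsimp only
  rw [e4, ← integral_comp_sub_mul_pressureSource hlam (hasCompactSupport_newtonFarLaplacian h₀.le h₁) hv x]
  congr 1
  have h := integral_sub_left_eq_self
    (fun z => newtonFarLaplacian r₀ r₁ z * pressureSource v (x - z)) volume x
  simp only [sub_sub_cancel] at h
  exact h

/-- **The weak Laplacian of the near potential**: `∫ Q₁[v] Δφ = ∫ φ (G − λ * G)` for `v ∈ C⁴`
(the tree's classical `ΔQ₁ = G − λ * G` and Green's identity). [cite: GilbargTrudinger2001, (2.17)] -/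
theorem integral_nearPotential_mul_laplacian (h₀ : 0 < r₀) (h₁ : r₀ < r₁)
    {v : EuclideanSpace ℝ (Fin 3) → EuclideanSpace ℝ (Fin 3)} (hv : ContDiff ℝ 4 v)
    {φ : EuclideanSpace ℝ (Fin 3) → ℝ} (hφ : ContDiff ℝ 2 φ) (hφc : HasCompactSupport φ) :
    ∫ x, nearPotential r₀ r₁ v x * (Δ φ) x =
      ∫ x, φ x * (pressureSource v x - ∫ z, newtonFarLaplacian r₀ r₁ z * pressureSource v (x - z)) := by
  have hQ : ContDiff ℝ 2 (nearPotential r₀ r₁ v) :=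
    contDiff_nearPotential h₀.le h₁ 2 (by exact_mod_cast hv)
  have h := integral_mul_laplacian_comm hQ hφ hφc
  calc ∫ x, nearPotential r₀ r₁ v x * (Δ φ) x = ∫ x, (Δ φ) x * nearPotential r₀ r₁ v x :=
        integral_congr_ae (Eventually.of_forall fun x => mul_comm _ _)
    _ = ∫ x, φ x * (Δ (nearPotential r₀ r₁ v)) x := h.symm
    _ = _ := integral_congr_ae (Eventually.of_forall fun x => by
          dsimp only; rw [laplacian_nearPotential h₀ h₁ hv])

/-- **The weak pressure Poisson equation for the Riesz pressure modulo constants**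
(Seregin 2014, Lemma 6.5: `Δq_F = −div div F` in `𝒟'`, with `F = v ⊗ v`): for `v ∈ C⁴` bounded
and every test function `φ`, `∫ Q̃ Δφ = −∫ D²φ(v, v)`. [cite: Seregin2014, §6.2 Lemma 6.5] -/
theorem integral_pressurePotentialMod_mul_laplacian
    {v : EuclideanSpace ℝ (Fin 3) → EuclideanSpace ℝ (Fin 3)} (hv : ContDiff ℝ 4 v) {N : ℝ}
    (hN : ∀ y, ‖v y‖ ≤ N) (x₀ : EuclideanSpace ℝ (Fin 3))
    {φ : EuclideanSpace ℝ (Fin 3) → ℝ} (hφ : ContDiff ℝ ∞ φ) (hφc : HasCompactSupport φ) :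
    ∫ x, pressurePotentialMod x₀ v x * (Δ φ) x = -∫ x, fderiv ℝ (fderiv ℝ φ) x (v x) (v x) := by
  have hφ2 : ContDiff ℝ 2 φ := contDiff_infty.1 hφ 2
  have hv2 : ContDiff ℝ 2 v := hv.of_le (by norm_num)
  have hΔφc : Continuous (Δ φ) := FluidPDE.continuous_laplacian hφ2
  have hΔφs : HasCompactSupport (Δ φ) := hφc.mono' fun x hx => by
    contrapose! hx
    simp [FluidPDE.laplacian_eq_zero_of_notMem_tsupport hx]
  have hG : Continuous (pressureSource v) := (contDiff_pressureSource (n := 0) (by exact_mod_cast hv2)).continuous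
  -- `λ * G` is continuous (an `L¹` kernel vanishing off a ball against a continuous function)
  have hLG : Continuous fun x => ∫ z, newtonFarLaplacian 1 2 z * pressureSource v (x - z) := by
    have hk : Integrable (newtonFarLaplacian (1 : ℝ) 2) :=
      (contDiff_newtonFarLaplacian one_pos one_lt_two (n := 0)).continuous.integrable_of_hasCompactSupport
        (hasCompactSupport_newtonFarLaplacian zero_le_one one_lt_two)
    have h := continuous_integral_smul_comp_sub hk
      (fun z hz => newtonFarLaplacian_eq_zero_of_gt zero_le_one one_lt_two hz) hG
    simpa only [smul_eq_mul] using h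
  have hQ1c : Continuous (nearPotential 1 2 v) :=
    (contDiff_nearPotential zero_le_one one_lt_two 0 (by exact_mod_cast hv2)).continuous
  have hQ2c : Continuous (farPotentialMod 1 2 x₀ v) :=
    continuous_farPotentialMod one_pos one_lt_two hv.continuous hN x₀
  have iQ1 : Integrable fun x => nearPotential 1 2 v x * (Δ φ) x :=
    (hQ1c.mul hΔφc).integrable_of_hasCompactSupport hΔφs.mul_left
  have iQ2 : Integrable fun x => farPotentialMod 1 2 x₀ v x * (Δ φ) x :=
    (hQ2c.mul hΔφc).integrable_of_hasCompactSupport hΔφs.mul_left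
  have iG : Integrable fun x => φ x * pressureSource v x :=
    (hφ.continuous.mul hG).integrable_of_hasCompactSupport hφc.mul_right
  have iLG : Integrable fun x => φ x * ∫ z, newtonFarLaplacian 1 2 z * pressureSource v (x - z) :=
    (hφ.continuous.mul hLG).integrable_of_hasCompactSupport hφc.mul_right
  have e : ∀ x, pressurePotentialMod x₀ v x * (Δ φ) x =
      -(nearPotential 1 2 v x * (Δ φ) x) - farPotentialMod 1 2 x₀ v x * (Δ φ) x := fun x => by
    unfold pressurePotentialMod; ring
  have iQ1n : Integrable fun x => -(nearPotential 1 2 v x * (Δ φ) x) := iQ1.neg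
  simp_rw [e]
  rw [integral_sub iQ1n iQ2, integral_neg,
    integral_nearPotential_mul_laplacian one_pos one_lt_two hv hφ2 hφc,
    integral_farPotentialMod_mul_laplacian one_pos one_lt_two hv2 hN x₀ hφ2 hφc]
  have e2 : ∫ x, φ x * (pressureSource v x - ∫ z, newtonFarLaplacian 1 2 z * pressureSource v (x - z)) =
      (∫ x, φ x * pressureSource v x) -
        ∫ x, φ x * ∫ z, newtonFarLaplacian 1 2 z * pressureSource v (x - z) := by
    rw [← integral_sub iG iLG]
    exact integral_congr_ae (Eventually.of_forall fun x => mul_sub _ _ _)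
  rw [e2, integral_mul_pressureSource hφ2 hφc hv2]
  ring

end Poisson

end Literature.Analysis.FluidPDE

end
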